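import Mathlib
import HarnessLib
import Summits.Ventures.LatticeQCDFlow.Exactness.LatticeCoordAvg

/-!
# The Hoeffding–Bessel lower bound for the variance on a finite product of compact probability spaces: `Σ_i Var(A_{Λ∖P_i} G) ≤ Var(G)` for pairwise disjoint coordinate blocks `P_i` — the lower companion of Efron–Stein

HONEST FRAMING: exact (Metropolis-corrected) sampling algorithms for lattice gauge theory;
figures of merit are autocorrelation/cost numbers at stated couplings and volumes; no
continuum-physics claim.

Venture `LatticeQCDFlow` (cell pub-lqcd), topic `Exactness`; FANOUT row 7 (`s0-cpn-null`).  NEW WORK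
of the cell over the tree's `Exactness/LatticeCoordAvg.lean` (coordinate averages `A_s`: gluing two
independent samples is measure preserving, `E[A_s G] = E[G]`, `A_s(ΦH) = ΦA_sH` for `s`-invariant `Φ`);
nothing is cited as a fact ([folklore]: the first layer of the Hoeffding / Efron–Stein orthogonal
decomposition — the conditional expectations given DISJOINT blocks of independent coordinates are
orthogonal, and Bessel's inequality; B. Efron, C. Stein, Ann. Statist. 9 (1981) for the upper companion
proved in `Exactness/LatticeEfronStein.lean`).  Use in this lineage's barrier leg: the block terms of the
extensive entropy floor are bounded below by variances of corridor averages of static block terms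
(`Exactness/SphereLOFlowEntropyFloorVariance.lean`, `CenteredExponentialMomentVarianceFloor.lean`);
by this file such a variance is at least the SUM, over disjoint groups of sites inside the block, of
the variances of the conditional expectations given each group — for the lattice CP(N−1)/O(N) action a
sum of explicit two-spin integrals.

## Setting

`ι` finite; `X` compact metric Borel with a probability measure `μ`; `π = ⊗_ι μ`; `A_s = coordAvg μ s`;
`P_i` (`i ∈ T`) pairwise disjoint finite sets of coordinates; `E[G | ω_{P_i}] = A_{univ ∖ P_i} G`.

## Content

* §1 `piecewise_piecewise_eq_union_piecewise`, **`coordAvg_coordAvg_eq_union`** — `A_s(A_t G) = A_{t ∪ s} G` for ALL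
  finite `s, t` (continuous `G`); `coordAvg_compl_invariant` (`A_{univ∖P} G` is `(univ∖P)`-invariant).
* §2 ORTHOGONALITY: **`integral_condExp_mul_condExp_eq_zero`** — for disjoint `P, P'`,
  `∫ (A_{univ∖P} G − m)(A_{univ∖P'} G − m) dπ = 0`; **`integral_centered_mul_condExp`** —
  `∫ (G − m)(A_{univ∖P} G − m) dπ = ∫ (A_{univ∖P} G − m)² dπ` (`m = ∫G dπ`).
* §3 **`sum_variance_condExp_le_variance`** — BESSEL: `Σ_{i∈T} ∫(A_{univ∖P_i} G − m)² dπ ≤ ∫(G − m)² dπ`.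

NOT CLAIMED: the full Hoeffding decomposition (higher layers); `L²` generality.
-/

noncomputable section

namespace Summit.Ventures.LatticeQCDFlow.Exactness

open MeasureTheory Function Set

variable {ι : Type*} [Fintype ι] [DecidableEq ι]
variable {X : Type*} [MeasurableSpace X] [MetricSpace X] [CompactSpace X] [BorelSpace X]
variable (μ : Measure X) [IsProbabilityMeasure μ]

/-! ## §1 Composition of coordinate averages over arbitrary sets -/

section Union

omit [Fintype ι] [MeasurableSpace X] [MetricSpace X] [CompactSpace X] [BorelSpace X] in
/-- Gluing `ω''` along `t` into the configuration glued from `ω'` along `s` is gluing `t.piecewise ω'' ω'`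
along `t ∪ s`. -/
theorem piecewise_piecewise_eq_union_piecewise (s t : Finset ι) (ω ω' ω'' : ι → X) :
    t.piecewise ω'' (s.piecewise ω' ω) = (t ∪ s).piecewise (t.piecewise ω'' ω') ω := by
  funext i
  by_cases hit : i ∈ t
  · rw [Finset.piecewise_eq_of_mem _ _ _ hit, Finset.piecewise_eq_of_mem _ _ _ (Finset.mem_union_left s hit),
      Finset.piecewise_eq_of_mem _ _ _ hit]
  · rw [Finset.piecewise_eq_of_notMem _ _ _ hit]
    by_cases his : i ∈ s
    · rw [Finset.piecewise_eq_of_mem _ _ _ his, Finset.piecewise_eq_of_mem _ _ _ (Finset.mem_union_right t his),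
        Finset.piecewise_eq_of_notMem _ _ _ hit]
    · rw [Finset.piecewise_eq_of_notMem _ _ _ his, Finset.piecewise_eq_of_notMem _ _ _ (by
        rw [Finset.mem_union]; push Not; exact ⟨hit, his⟩)]

/-- **`A_s(A_t G) = A_{t ∪ s} G` for all finite `s, t`** (continuous `G`): successive averages over
independent coordinate sets compose to the average over the union (two independent samples glue to
one, `map_piecewise_pi_prod`). -/
theorem coordAvg_coordAvg_eq_union (s t : Finset ι) {G : (ι → X) → ℝ} (hG : Continuous G) (ω : ι → X) :
    coordAvg μ s (coordAvg μ t G) ω = coordAvg μ (t ∪ s) G ω := by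
  have hglue : ∀ ω' ω'' : ι → X,
      G (t.piecewise ω'' (s.piecewise ω' ω)) = G ((t ∪ s).piecewise (t.piecewise ω'' ω') ω) :=
    fun ω' ω'' => by rw [piecewise_piecewise_eq_union_piecewise]
  have hc2 : Continuous fun p : (ι → X) × (ι → X) => G ((t ∪ s).piecewise (t.piecewise p.2 p.1) ω) :=
    hG.comp (((continuous_piecewise_prod (t ∪ s)).comp
      ((Continuous.prodMk_right ω).comp (continuous_piecewise_prod t))))
  have hint : Integrable (fun p : (ι → X) × (ι → X) => G ((t ∪ s).piecewise (t.piecewise p.2 p.1) ω))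
      ((Measure.pi (fun _ : ι => μ)).prod (Measure.pi (fun _ : ι => μ))) :=
    hc2.integrable_of_hasCompactSupport (HasCompactSupport.of_compactSpace _)
  have hcζ : Continuous fun ζ : ι → X => G ((t ∪ s).piecewise ζ ω) :=
    hG.comp ((continuous_piecewise_prod (t ∪ s)).comp (Continuous.prodMk_right ω))
  unfold coordAvg
  simp_rw [hglue]
  rw [← integral_prod _ hint]
  have hR : ∫ p : (ι → X) × (ι → X), G ((t ∪ s).piecewise (t.piecewise p.2 p.1) ω)
      ∂(Measure.pi (fun _ : ι => μ)).prod (Measure.pi (fun _ : ι => μ)) =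
      ∫ ζ, G ((t ∪ s).piecewise ζ ω) ∂Measure.map (fun p : (ι → X) × (ι → X) => t.piecewise p.2 p.1)
        ((Measure.pi (fun _ : ι => μ)).prod (Measure.pi (fun _ : ι => μ))) :=
    (integral_map (φ := fun p : (ι → X) × (ι → X) => t.piecewise p.2 p.1)
      (f := fun ζ => G ((t ∪ s).piecewise ζ ω))
      (measurable_piecewise_prod t).aemeasurable hcζ.aestronglyMeasurable).symm
  rw [hR, map_piecewise_pi_prod μ t]

omit [MetricSpace X] [CompactSpace X] [BorelSpace X] [IsProbabilityMeasure μ] in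
/-- `A_s G` is invariant under re-gluing the `s`-coordinates (restated pointwise for products). -/
theorem coordAvg_invariant (s : Finset ι) (G : (ι → X) → ℝ) (ω ω' : ι → X) :
    coordAvg μ s G (s.piecewise ω' ω) = coordAvg μ s G ω :=
  coordAvg_apply_piecewise μ s G ω ω'

end Union

/-! ## §2 Orthogonality of conditional expectations given disjoint blocks -/

section Orthogonal

/-- **ORTHOGONALITY**: for DISJOINT coordinate blocks `P, P'` and `m = ∫G dπ`,
`∫ (A_{univ∖P} G − m)·(A_{univ∖P'} G − m) dπ = 0` — the conditional expectations of `G` given the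
coordinates in `P` and in `P'` are uncorrelated (`A_{univ∖P}(A_{univ∖P'} G) = A_{univ} G = m`). -/
theorem integral_condExp_mul_condExp_eq_zero {P P' : Finset ι} (hPP' : Disjoint P P') {G : (ι → X) → ℝ}
    (hG : Continuous G) :
    ∫ ω, (coordAvg μ (Finset.univ \ P) G ω - ∫ ω', G ω' ∂Measure.pi (fun _ : ι => μ)) *
        (coordAvg μ (Finset.univ \ P') G ω - ∫ ω', G ω' ∂Measure.pi (fun _ : ι => μ))
        ∂Measure.pi (fun _ : ι => μ) = 0 := by
  set m : ℝ := ∫ ω', G ω' ∂Measure.pi (fun _ : ι => μ) with hm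
  set S : Finset ι := Finset.univ \ P with hS
  set S' : Finset ι := Finset.univ \ P' with hS'
  have hA : Continuous (coordAvg μ S G) := continuous_coordAvg μ S hG
  have hA' : Continuous (coordAvg μ S' G) := continuous_coordAvg μ S' hG
  have hg : Continuous fun ω => coordAvg μ S G ω - m := hA.sub continuous_const
  have hg' : Continuous fun ω => coordAvg μ S' G ω - m := hA'.sub continuous_const
  -- `g = A_S G − m` is `S`-invariant, so `A_S(g·g') = g·A_S g'`
  have hinv : ∀ ω ω', (coordAvg μ S G (S.piecewise ω' ω) - m) = coordAvg μ S G ω - m :=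
    fun ω ω' => by rw [coordAvg_invariant μ S G ω ω']
  have hunion : S' ∪ S = Finset.univ := by
    ext i
    simp only [Finset.mem_union, Finset.mem_sdiff, Finset.mem_univ, true_and, iff_true, hS, hS']
    by_cases hi : i ∈ P
    · exact Or.inl (fun hi' => Finset.disjoint_left.1 hPP' hi hi')
    · exact Or.inr hi
  -- `A_S g' = A_S(A_{S'} G) − m = A_univ G − m = 0`
  have hASg' : ∀ ω, coordAvg μ S (fun ω => coordAvg μ S' G ω - m) ω = 0 := by
    intro ω
    rw [coordAvg_sub μ S hA' continuous_const, coordAvg_const, coordAvg_coordAvg_eq_union μ S S' hG,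
      hunion, coordAvg_univ, ← hm, sub_self]
  calc ∫ ω, (coordAvg μ S G ω - m) * (coordAvg μ S' G ω - m) ∂Measure.pi (fun _ : ι => μ)
      = ∫ ω, coordAvg μ S (fun ω => (coordAvg μ S G ω - m) * (coordAvg μ S' G ω - m)) ω
          ∂Measure.pi (fun _ : ι => μ) := (integral_coordAvg μ S (hg.mul hg')).symm
    _ = ∫ ω, (coordAvg μ S G ω - m) * coordAvg μ S (fun ω => coordAvg μ S' G ω - m) ω
          ∂Measure.pi (fun _ : ι => μ) := by
        refine integral_congr_ae (ae_of_all _ fun ω => ?_)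
        exact coordAvg_mul_left μ S (Φ := fun ω => coordAvg μ S G ω - m) hinv ω
    _ = 0 := by simp [hASg']

/-- **`∫ (G − m)(A_{univ∖P} G − m) dπ = ∫ (A_{univ∖P} G − m)² dπ`**: the centred conditional expectation
is the orthogonal projection of the centred `G` (`E[(G − A_S G)·Φ] = 0` for `S`-invariant `Φ`). -/
theorem integral_centered_mul_condExp (P : Finset ι) {G : (ι → X) → ℝ} (hG : Continuous G) :
    ∫ ω, (G ω - ∫ ω', G ω' ∂Measure.pi (fun _ : ι => μ)) *
        (coordAvg μ (Finset.univ \ P) G ω - ∫ ω', G ω' ∂Measure.pi (fun _ : ι => μ))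
        ∂Measure.pi (fun _ : ι => μ) =
      ∫ ω, (coordAvg μ (Finset.univ \ P) G ω - ∫ ω', G ω' ∂Measure.pi (fun _ : ι => μ)) ^ 2
        ∂Measure.pi (fun _ : ι => μ) := by
  set m : ℝ := ∫ ω', G ω' ∂Measure.pi (fun _ : ι => μ) with hm
  set S : Finset ι := Finset.univ \ P with hS
  have hA : Continuous (coordAvg μ S G) := continuous_coordAvg μ S hG
  have hg : Continuous fun ω => coordAvg μ S G ω - m := hA.sub continuous_const
  have hinv : ∀ ω ω', (coordAvg μ S G (S.piecewise ω' ω) - m) = coordAvg μ S G ω - m :=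
    fun ω ω' => by rw [coordAvg_invariant μ S G ω ω']
  -- `∫ (G − A_S G)·g = 0`
  have horth := integral_sub_coordAvg_mul_eq_zero μ S hG hg hinv
  have e : ∀ ω, (G ω - m) * (coordAvg μ S G ω - m) =
      (G ω - coordAvg μ S G ω) * (coordAvg μ S G ω - m) + (coordAvg μ S G ω - m) ^ 2 := by
    intro ω; ring
  simp_rw [e]
  have hi1 : Integrable (fun ω => (G ω - coordAvg μ S G ω) * (coordAvg μ S G ω - m)) (Measure.pi fun _ : ι => μ) :=
    integrable_pi_of_continuous μ ((hG.sub hA).mul hg)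
  have hi2 : Integrable (fun ω => (coordAvg μ S G ω - m) ^ 2) (Measure.pi fun _ : ι => μ) :=
    integrable_pi_of_continuous μ (hg.pow 2)
  rw [integral_add hi1 hi2, horth, zero_add]

end Orthogonal

/-! ## §3 Bessel's inequality: the first Hoeffding layer is below the variance -/

section Bessel

/-- **THE HOEFFDING–BESSEL LOWER BOUND**: for pairwise disjoint coordinate blocks `P_i` (`i ∈ T`) and a
continuous `G` with mean `m`,
`Σ_{i∈T} ∫(A_{univ∖P_i} G − m)² dπ ≤ ∫(G − m)² dπ` — the variances of the conditional expectations of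
`G` given disjoint groups of independent coordinates add up to at most the variance of `G` (they are
orthogonal projections of the centred `G` onto mutually orthogonal subspaces). -/
theorem sum_variance_condExp_le_variance {J : Type*} (T : Finset J) (P : J → Finset ι)
    (hP : ∀ i ∈ T, ∀ i' ∈ T, i ≠ i' → Disjoint (P i) (P i')) {G : (ι → X) → ℝ} (hG : Continuous G) :
    ∑ i ∈ T, ∫ ω, (coordAvg μ (Finset.univ \ P i) G ω - ∫ ω', G ω' ∂Measure.pi (fun _ : ι => μ)) ^ 2
        ∂Measure.pi (fun _ : ι => μ) ≤
      ∫ ω, (G ω - ∫ ω', G ω' ∂Measure.pi (fun _ : ι => μ)) ^ 2 ∂Measure.pi (fun _ : ι => μ) := by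
  set π : Measure (ι → X) := Measure.pi (fun _ : ι => μ) with hπ
  set m : ℝ := ∫ ω', G ω' ∂π with hm
  set g : J → (ι → X) → ℝ := fun i ω => coordAvg μ (Finset.univ \ P i) G ω - m with hgdef
  have hgc : ∀ i, Continuous (g i) := fun i => (continuous_coordAvg μ _ hG).sub continuous_const
  have hGm : Continuous fun ω => G ω - m := hG.sub continuous_const
  have hsumc : Continuous fun ω => ∑ i ∈ T, g i ω := continuous_finsetSum _ fun i _ => hgc i
  -- Gram relations
  have hdiag : ∀ i ∈ T, ∫ ω, (G ω - m) * g i ω ∂π = ∫ ω, g i ω ^ 2 ∂π :=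
    fun i _ => integral_centered_mul_condExp μ (P i) hG
  have hoff : ∀ i ∈ T, ∀ i' ∈ T, i ≠ i' → ∫ ω, g i ω * g i' ω ∂π = 0 :=
    fun i hi i' hi' hne => integral_condExp_mul_condExp_eq_zero μ (hP i hi i' hi' hne) hG
  -- expand `0 ≤ ∫ (G − m − Σ g_i)²`
  have hnn : 0 ≤ ∫ ω, ((G ω - m) - ∑ i ∈ T, g i ω) ^ 2 ∂π := integral_nonneg fun ω => sq_nonneg _
  have e : ∀ ω, ((G ω - m) - ∑ i ∈ T, g i ω) ^ 2 =
      (G ω - m) ^ 2 - 2 * ∑ i ∈ T, (G ω - m) * g i ω + ∑ i ∈ T, ∑ i' ∈ T, g i ω * g i' ω := by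
    intro ω
    have h1 : (G ω - m) * ∑ i ∈ T, g i ω = ∑ i ∈ T, (G ω - m) * g i ω := Finset.mul_sum _ _ _
    have h2 : (∑ i ∈ T, g i ω) * (∑ i' ∈ T, g i' ω) = ∑ i ∈ T, ∑ i' ∈ T, g i ω * g i' ω :=
      Finset.sum_mul_sum _ _ _ _
    rw [← h1, ← h2]; ring
  simp_rw [e] at hnn
  have hi1 : Integrable (fun ω => (G ω - m) ^ 2) π := integrable_pi_of_continuous μ (hGm.pow 2)
  have hi2 : Integrable (fun ω => 2 * ∑ i ∈ T, (G ω - m) * g i ω) π :=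
    (integrable_pi_of_continuous μ (continuous_finsetSum _ fun i _ => hGm.mul (hgc i))).const_mul 2
  have hi3 : Integrable (fun ω => ∑ i ∈ T, ∑ i' ∈ T, g i ω * g i' ω) π :=
    integrable_pi_of_continuous μ (continuous_finsetSum _ fun i _ =>
      continuous_finsetSum _ fun i' _ => (hgc i).mul (hgc i'))
  have hi12 : Integrable (fun ω => (G ω - m) ^ 2 - 2 * ∑ i ∈ T, (G ω - m) * g i ω) π := hi1.sub hi2
  have hI1 : ∀ i ∈ T, Integrable (fun ω => (G ω - m) * g i ω) π :=
    fun i _ => integrable_pi_of_continuous μ (show Continuous (fun ω => (G ω - m) * g i ω) from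
      hGm.mul (hgc i))
  have hI2 : ∀ i ∈ T, Integrable (fun ω => ∑ i' ∈ T, g i ω * g i' ω) π :=
    fun i _ => integrable_pi_of_continuous μ (continuous_finsetSum _ fun i' _ =>
      show Continuous (fun ω => g i ω * g i' ω) from (hgc i).mul (hgc i'))
  have hI3 : ∀ i ∈ T, ∀ i' ∈ T, Integrable (fun ω => g i ω * g i' ω) π :=
    fun i _ i' _ => integrable_pi_of_continuous μ (show Continuous (fun ω => g i ω * g i' ω) from
      (hgc i).mul (hgc i'))
  rw [integral_add hi12 hi3, integral_sub hi1 hi2, integral_const_mul, integral_finsetSum _ hI1,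
    integral_finsetSum _ hI2] at hnn
  have hinner : ∀ i ∈ T, ∫ ω, ∑ i' ∈ T, g i ω * g i' ω ∂π = ∫ ω, g i ω ^ 2 ∂π := by
    intro i hi
    rw [integral_finsetSum _ (hI3 i hi)]
    rw [Finset.sum_eq_single_of_mem i hi (fun i' hi' hne => hoff i hi i' hi' (Ne.symm hne))]
    simp only [sq]
  rw [Finset.sum_congr rfl hdiag, Finset.sum_congr rfl hinner] at hnn
  have : ∑ i ∈ T, ∫ ω, g i ω ^ 2 ∂π ≤ ∫ ω, (G ω - m) ^ 2 ∂π := by linarith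
  simpa only [hgdef] using this

end Bessel

end Summit.Ventures.LatticeQCDFlow.Exactness

end
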